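/-
COR-CM (cell pub-hodgecm2) — ¬hJ RUSH, track M1′ ∕ M2-mult bridge (nothj-plan table r3; LEAD d2bridge-wb-9), seat nothj-p6 g0 (prover-pub-hodgecm2-nothj-p6-g0-0).
THE TWO-SOCKET ENGINE IN THE TREE'S [Liu2021, Prop. 4.13]-CURRENCY.  THEOREMS ONLY; no `def`, no named fact, no `sorry`.
FRAMING: HC_CM is NOT proved; nothing here asserts hJ, hJ₀ or their negations.
-/
import Summits.HodgeConjecture.CorCM.D2Bridge.NotHJTwoSocket
import Literature.NumberTheory.Automorphic.Liu2021.Def411AsPrinted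
import HarnessLib

/-!
# The two-socket engine fed by an equivariant direct-sum decomposition `σ413 ∕ Φ413 ∕ hΦ413 ∕ h411W ∕ hsepW`

[Liu2021] Y. Liu, *Fourier–Jacobi cycles and arithmetic relative trace formula*, Camb. J. Math. **9** (2021) = arXiv:2102.11518.

The END-ELECT's Hodge-blind displayed rows h413 (`Prop413AsPrinted (U.prop413Data T.H)`: an equivariant `T.H ≃ₗ[ℂ] ⨁_t ω_t`), h411
(`IsIrreducibleOrZero` of every `ω_t`, READING I1) and hμsep ∕ hD3 (pairwise non-isomorphy) are consumed by the tree in exactly the currency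
`(σ413, Φ413, hΦ413, h411W, hsepW)` (✔ `HcmPieces.thm418Combined_of_asPrinted_resolved_of_decomposition` :204–:210, ✔ `Thm418COfPieces.lean`
:149–:155, ✔ `UniformOmega.rank_intertwiningMap_rhoAt_rest_le_one_of_prop413AsPrinted`).  Here the same binders (with `h411W` weakened to its
first clause) yield the `ℂ[G]`-module facts the two-socket engine needs: the `ℂ[G]`-spans of the NON-ZERO summands `Φ⁻¹(ω_t)` are simple
(`isSimpleModule_span_summand`), pairwise non-isomorphic (`eq_of_linearEquiv_span_summand`), independent (`iSupIndep_span_summand`) and exhaust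
(`iSup_span_summand_eq_top`); whence `false_of_twoSocket_of_equivariant_directSum` — the κ-free finish line HEAD-A modulo the rows, in the
shape the HEAD skeleton consumes.  Universe-0 carriers as in the tree.  HC_CM is NOT proved; hJ ∕ ¬hJ are not asserted.

## References
* [Liu2021] Prop. 4.13 (FJcycle.tex l. 2113–2119), Def. 4.11 (l. 2083–2097), App. D Lem. D.1 (3), Thm. 4.18 (1),(2).
* [VoisinHodgeI2002] C. Voisin, *Hodge Theory and Complex Algebraic Geometry I*, CUP 2002, §6.1.3 Cor. 6.14; §7.3.2.
-/

set_option autoImplicit false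

noncomputable section

namespace Summit.HodgeConjecture.CorCM.D2Bridge.NotHJ

open Function DirectSum
open Literature.NumberTheory.Automorphic.Liu2021 (IsIrreducibleOrZero)

/-! ## §1 Summand spans of an equivariant decomposition; §2 the engine

The END-ELECT's Hodge-blind displayed rows h413 (`Prop413AsPrinted (U.prop413Data T.H)`: an equivariant `T.H ≃ₗ[ℂ] ⨁_t ω_t`), h411
(`IsIrreducibleOrZero` of every `ω_t`) and hμsep∕hD3 (pairwise non-isomorphy) are consumed by the tree in exactly this currency
(✔ `HcmPieces.lean` :204–:210, ✔ `Thm418COfPieces.lean` :149–:155, ✔ `UniformOmega.rank_intertwiningMap_rhoAt_rest_le_one_of_prop413AsPrinted`).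
Here the same binders yield the `ℂ[G]`-module facts §3 needs: the spans `span ℂ[G] (Φ⁻¹ ω_t)` of the NON-ZERO summands are simple
(`isSimpleModule_span_summand`), pairwise non-isomorphic (`eq_of_linearEquiv_span_summand`), independent (`iSupIndep_span_summand`) and
exhaust (`iSup_span_summand_eq_top`); whence `false_of_twoSocket_of_equivariant_directSum`. -/

section DirectSum413

-- universe-0 carriers, as in the tree's currency (`IsIrreducibleOrZero` is stated over `{G V : Type}`; ✔ `HcmPieces.lean` :204–:210)
variable {G : Type} [Group G]
variable {Hc : Type} [AddCommGroup Hc] [Module ℂ Hc] [Module (MonoidAlgebra ℂ G) Hc] [IsScalarTower ℂ (MonoidAlgebra ℂ G) Hc]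
variable {ι413 : Type} [DecidableEq ι413] {W413 : ι413 → Type} [∀ t, AddCommGroup (W413 t)] [∀ t, Module ℂ (W413 t)]

/-- `Representation.ofModule'` is the action of the group elements `of g ∈ ℂ[G]` (Mathlib, by `simp`). [folklore] -/
theorem ofModule'_apply_eq_of_smul (g : G) (x : Hc) :
    Representation.ofModule' (k := ℂ) (G := G) Hc g x = MonoidAlgebra.of ℂ G g • x := by
  simp [Representation.ofModule', MonoidAlgebra.lift_symm_apply, Algebra.lsmul_coe]

/-- The `t`-th summand read in `Hc` through `Φ⁻¹`: `Φ (Φ⁻¹ (lof t w)) = lof t w`. [folklore] -/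
theorem apply_symm_lof (Φ413 : Hc ≃ₗ[ℂ] ⨁ t, W413 t) (t : ι413) (w : W413 t) :
    Φ413 (Φ413.symm (lof ℂ ι413 W413 t w)) = lof ℂ ι413 W413 t w :=
  Φ413.apply_symm_apply _

/-- **Equivariance of the summand embeddings**: `of g • Φ⁻¹(lof t w) = Φ⁻¹(lof t (σ_t(g) w))`. [cite: Liu2021, Prop. 4.13] -/
theorem of_smul_symm_lof (σ413 : ∀ t, Representation ℂ G (W413 t)) (Φ413 : Hc ≃ₗ[ℂ] ⨁ t, W413 t)
    (hΦ413 : ∀ (g : G) (x : Hc) (t : ι413), Φ413 (Representation.ofModule' (k := ℂ) (G := G) Hc g x) t = σ413 t g (Φ413 x t))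
    (g : G) (t : ι413) (w : W413 t) :
    MonoidAlgebra.of ℂ G g • Φ413.symm (lof ℂ ι413 W413 t w) = Φ413.symm (lof ℂ ι413 W413 t (σ413 t g w)) := by
  apply Φ413.injective
  rw [Φ413.apply_symm_apply, ← ofModule'_apply_eq_of_smul]
  refine DFinsupp.ext fun t' => ?_
  rw [hΦ413, Φ413.apply_symm_apply]
  by_cases h : t = t'
  · subst h
    simp only [lof_eq_of, of_eq_same]
  · rw [lof_eq_of, lof_eq_of, of_eq_of_ne _ _ _ (Ne.symm h), of_eq_of_ne _ _ _ (Ne.symm h), map_zero]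

/-- Every element of the `ℂ[G]`-span of a summand IS an element of the summand (the summand is `ℂ[G]`-stable). [cite: Liu2021, Prop. 4.13] -/
theorem exists_eq_of_mem_span (σ413 : ∀ t, Representation ℂ G (W413 t)) (Φ413 : Hc ≃ₗ[ℂ] ⨁ t, W413 t)
    (hΦ413 : ∀ (g : G) (x : Hc) (t : ι413), Φ413 (Representation.ofModule' (k := ℂ) (G := G) Hc g x) t = σ413 t g (Φ413 x t))
    (t : ι413) {y : Hc}
    (hy : y ∈ Submodule.span (MonoidAlgebra ℂ G) (Set.range fun w : W413 t => Φ413.symm (lof ℂ ι413 W413 t w))) :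
    ∃ w : W413 t, y = Φ413.symm (lof ℂ ι413 W413 t w) := by
  induction hy using Submodule.span_induction with
  | mem x hx => obtain ⟨w, rfl⟩ := hx; exact ⟨w, rfl⟩
  | zero => exact ⟨0, by rw [map_zero, map_zero]⟩
  | add x y _ _ hx hy =>
    obtain ⟨a, rfl⟩ := hx; obtain ⟨b, rfl⟩ := hy
    exact ⟨a + b, by rw [map_add, map_add]⟩
  | smul r x _ hx =>
    obtain ⟨a, rfl⟩ := hx
    induction r using MonoidAlgebra.induction_linear with
    | zero => exact ⟨0, by rw [zero_smul, map_zero, map_zero]⟩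
    | add r s hr hs =>
      obtain ⟨b, hb⟩ := hr; obtain ⟨c, hc⟩ := hs
      exact ⟨b + c, by rw [add_smul, hb, hc, map_add, map_add]⟩
    | single g c =>
      have hs : MonoidAlgebra.single g c = c • MonoidAlgebra.of ℂ G g := by
        rw [MonoidAlgebra.of_apply, MonoidAlgebra.smul_single', mul_one]
      refine ⟨c • σ413 t g a, ?_⟩
      rw [map_smul, map_smul, hs, smul_assoc, of_smul_symm_lof σ413 Φ413 hΦ413]

/-- The summand embedding `w ↦ Φ⁻¹(lof t w)` is injective. [folklore] -/
theorem symm_lof_injective (Φ413 : Hc ≃ₗ[ℂ] ⨁ t, W413 t) (t : ι413) :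
    Injective fun w : W413 t => Φ413.symm (lof ℂ ι413 W413 t w) :=
  fun a b hab => of_injective (β := W413) t (by simpa [lof_eq_of] using Φ413.symm.injective hab)

/-- **The summand `span ℂ[G] (Φ⁻¹(ω_t))` is a SIMPLE `ℂ[G]`-module when `ω_t` is irreducible-or-zero and non-zero** ([Liu2021] Def. 4.11's
«irreducible», READING I1, transported through the equivariant decomposition). [cite: Liu2021, Def. 4.11 and Prop. 4.13] -/
theorem isSimpleModule_span_summand (σ413 : ∀ t, Representation ℂ G (W413 t)) (Φ413 : Hc ≃ₗ[ℂ] ⨁ t, W413 t)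
    (hΦ413 : ∀ (g : G) (x : Hc) (t : ι413), Φ413 (Representation.ofModule' (k := ℂ) (G := G) Hc g x) t = σ413 t g (Φ413 x t))
    (t : ι413) (h411 : IsIrreducibleOrZero (σ413 t)) [Nontrivial (W413 t)] :
    IsSimpleModule (MonoidAlgebra ℂ G)
      (Submodule.span (MonoidAlgebra ℂ G) (Set.range fun w : W413 t => Φ413.symm (lof ℂ ι413 W413 t w))) := by
  set ω := Submodule.span (MonoidAlgebra ℂ G) (Set.range fun w : W413 t => Φ413.symm (lof ℂ ι413 W413 t w)) with hω
  rw [isSimpleModule_iff_isAtom]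
  refine ⟨?_, fun N hN => ?_⟩
  · -- `ω ≠ ⊥`
    obtain ⟨w, hw⟩ := exists_ne (0 : W413 t)
    intro h0
    have hmem : Φ413.symm (lof ℂ ι413 W413 t w) ∈ ω := Submodule.subset_span ⟨w, rfl⟩
    rw [h0, Submodule.mem_bot] at hmem
    exact hw (symm_lof_injective Φ413 t (by simpa using hmem))
  · -- a proper `ℂ[G]`-submodule `N < ω` pulls back to a proper subrepresentation of `σ413 t`, hence is `⊥`
    let N' : Subrepresentation (σ413 t) :=
      { toSubmodule :=
          { carrier := {w | Φ413.symm (lof ℂ ι413 W413 t w) ∈ N}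
            add_mem' := fun {a b} ha hb => by
              change Φ413.symm (lof ℂ ι413 W413 t (a + b)) ∈ N
              rw [map_add, map_add]; exact N.add_mem ha hb
            zero_mem' := by change Φ413.symm (lof ℂ ι413 W413 t 0) ∈ N; rw [map_zero, map_zero]; exact N.zero_mem
            smul_mem' := fun c {a} ha => by
              change Φ413.symm (lof ℂ ι413 W413 t (c • a)) ∈ N
              rw [map_smul, map_smul]; exact N.smul_of_tower_mem c ha }
        apply_mem_toSubmodule := fun g {v} hv => by
          change Φ413.symm (lof ℂ ι413 W413 t (σ413 t g v)) ∈ N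
          rw [← of_smul_symm_lof σ413 Φ413 hΦ413]
          exact N.smul_mem _ hv }
    rcases h411 N' with h' | h'
    · -- `N' = ⊥`: every element of `N` is `Φ⁻¹(lof t w)` with `w ∈ N' = ⊥`
      rw [eq_bot_iff]
      intro y hy
      obtain ⟨w, rfl⟩ := exists_eq_of_mem_span σ413 Φ413 hΦ413 t (hN.1 hy)
      have hw : w ∈ N' := hy
      rw [h'] at hw
      have hw0 : w = 0 := (Submodule.mem_bot ℂ).1 hw
      rw [hw0, map_zero, map_zero]
      exact Submodule.zero_mem _
    · -- `N' = ⊤`: then `ω ≤ N`, contradicting `N < ω`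
      exfalso
      refine hN.2 (Submodule.span_le.2 ?_)
      rintro _ ⟨w, rfl⟩
      have : w ∈ N' := by rw [h']; trivial
      exact this

omit [IsScalarTower ℂ (MonoidAlgebra ℂ G) Hc] in
/-- Elements of `⨆_{j ≠ t} span ℂ[G] (Φ⁻¹ ω_j)` have `t`-component `0`. [folklore] -/
theorem apply_eq_zero_of_mem_iSup_ne (Φ413 : Hc ≃ₗ[ℂ] ⨁ t, W413 t) {κ : Type} (idx : κ → ι413) (t : ι413)
    {y : Hc} (hy : y ∈ ⨆ (j : κ) (_ : idx j ≠ t),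
      Submodule.span (MonoidAlgebra ℂ G) (Set.range fun w : W413 (idx j) => Φ413.symm (lof ℂ ι413 W413 (idx j) w)))
    (hstable : ∀ (j : κ), idx j ≠ t → ∀ z ∈ Submodule.span (MonoidAlgebra ℂ G)
        (Set.range fun w : W413 (idx j) => Φ413.symm (lof ℂ ι413 W413 (idx j) w)), ∃ w, z = Φ413.symm (lof ℂ ι413 W413 (idx j) w)) :
    Φ413 y t = 0 := by
  induction hy using Submodule.iSup_induction' with
  | mem j z hz =>
    by_cases hj : idx j ≠ t
    · rw [iSup_pos hj] at hz
      obtain ⟨w, rfl⟩ := hstable j hj z hz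
      rw [Φ413.apply_symm_apply, lof_eq_of, of_eq_of_ne _ _ _ (Ne.symm hj)]
    · rw [iSup_neg hj, Submodule.mem_bot] at hz
      rw [hz, map_zero, DirectSum.zero_apply]
  | zero => rw [map_zero, DirectSum.zero_apply]
  | add x y _ _ hx hy => rw [map_add, DirectSum.add_apply, hx, hy, add_zero]

/-- **Independence of the non-zero summands** `span ℂ[G] (Φ⁻¹ ω_t)`, `t` non-trivial. [cite: Liu2021, Prop. 4.13] -/
theorem iSupIndep_span_summand (σ413 : ∀ t, Representation ℂ G (W413 t)) (Φ413 : Hc ≃ₗ[ℂ] ⨁ t, W413 t)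
    (hΦ413 : ∀ (g : G) (x : Hc) (t : ι413), Φ413 (Representation.ofModule' (k := ℂ) (G := G) Hc g x) t = σ413 t g (Φ413 x t)) :
    iSupIndep fun t : {t : ι413 // Nontrivial (W413 t)} =>
      Submodule.span (MonoidAlgebra ℂ G) (Set.range fun w : W413 t.1 => Φ413.symm (lof ℂ ι413 W413 t.1 w)) := by
  rw [iSupIndep_def]
  intro t
  rw [Submodule.disjoint_def]
  intro x hx hx'
  obtain ⟨w, rfl⟩ := exists_eq_of_mem_span σ413 Φ413 hΦ413 t.1 hx
  have h0 : Φ413 (Φ413.symm (lof ℂ ι413 W413 t.1 w)) t.1 = 0 := by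
    refine apply_eq_zero_of_mem_iSup_ne (G := G) Φ413 (fun j : {t : ι413 // Nontrivial (W413 t)} => j.1) t.1 ?_ ?_
    · -- re-index `j ≠ t` (in the subtype) as `j.1 ≠ t.1`
      have hle : (⨆ (j : {t : ι413 // Nontrivial (W413 t)}) (_ : j ≠ t),
            Submodule.span (MonoidAlgebra ℂ G) (Set.range fun w : W413 j.1 => Φ413.symm (lof ℂ ι413 W413 j.1 w))) ≤
          ⨆ (j : {t : ι413 // Nontrivial (W413 t)}) (_ : j.1 ≠ t.1),
            Submodule.span (MonoidAlgebra ℂ G) (Set.range fun w : W413 j.1 => Φ413.symm (lof ℂ ι413 W413 j.1 w)) :=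
        iSup_mono fun j => iSup_mono' fun hj => ⟨fun h => hj (Subtype.ext h), le_rfl⟩
      exact hle hx'
    · intro j _ z hz
      exact exists_eq_of_mem_span σ413 Φ413 hΦ413 j.1 hz
  rw [Φ413.apply_symm_apply, lof_apply] at h0
  rw [h0, map_zero, map_zero]

omit [IsScalarTower ℂ (MonoidAlgebra ℂ G) Hc] in
/-- **The non-zero summands exhaust `Hc`**: `⨆_t span ℂ[G] (Φ⁻¹ ω_t) = ⊤`. [cite: Liu2021, Prop. 4.13] -/
theorem iSup_span_summand_eq_top (Φ413 : Hc ≃ₗ[ℂ] ⨁ t, W413 t) :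
    (⨆ t : {t : ι413 // Nontrivial (W413 t)},
      Submodule.span (MonoidAlgebra ℂ G) (Set.range fun w : W413 t.1 => Φ413.symm (lof ℂ ι413 W413 t.1 w))) = ⊤ := by
  rw [eq_top_iff]
  intro x _
  rw [← Φ413.symm_apply_apply x]
  induction Φ413 x using DirectSum.induction_on with
  | zero => rw [map_zero]; exact Submodule.zero_mem _
  | of t w =>
    by_cases ht : Nontrivial (W413 t)
    · refine Submodule.mem_iSup_of_mem ⟨t, ht⟩ (Submodule.subset_span ⟨w, ?_⟩)
      simp only [lof_eq_of]
    · rw [not_nontrivial_iff_subsingleton] at ht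
      rw [Subsingleton.elim w 0, map_zero, map_zero]
      exact Submodule.zero_mem _
  | add a b ha hb => rw [map_add]; exact Submodule.add_mem _ ha hb

/-- The summand embedding as a `ℂ`-linear EQUIVALENCE onto its `ℂ[G]`-span. [folklore] -/
theorem exists_linearEquiv_span_summand (σ413 : ∀ t, Representation ℂ G (W413 t)) (Φ413 : Hc ≃ₗ[ℂ] ⨁ t, W413 t)
    (hΦ413 : ∀ (g : G) (x : Hc) (t : ι413), Φ413 (Representation.ofModule' (k := ℂ) (G := G) Hc g x) t = σ413 t g (Φ413 x t))
    (t : ι413) :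
    ∃ es : W413 t ≃ₗ[ℂ] ↥(Submodule.span (MonoidAlgebra ℂ G) (Set.range fun w : W413 t => Φ413.symm (lof ℂ ι413 W413 t w))),
      ∀ w, ((es w : ↥(Submodule.span (MonoidAlgebra ℂ G)
        (Set.range fun w : W413 t => Φ413.symm (lof ℂ ι413 W413 t w)))) : Hc) = Φ413.symm (lof ℂ ι413 W413 t w) := by
  set ω := Submodule.span (MonoidAlgebra ℂ G) (Set.range fun w : W413 t => Φ413.symm (lof ℂ ι413 W413 t w)) with hω
  let lin : W413 t →ₗ[ℂ] ↥ω :=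
    { toFun := fun w => ⟨Φ413.symm (lof ℂ ι413 W413 t w), Submodule.subset_span ⟨w, rfl⟩⟩
      map_add' := fun a b => by ext; simp only [map_add, Submodule.coe_add]
      map_smul' := fun c a => by ext; simp only [map_smul, RingHom.id_apply, Submodule.coe_smul_of_tower] }
  have hbij : Bijective lin := by
    refine ⟨fun a b hab => symm_lof_injective Φ413 t (congrArg Subtype.val hab :), fun y => ?_⟩
    obtain ⟨w, hw⟩ := exists_eq_of_mem_span σ413 Φ413 hΦ413 t y.2
    exact ⟨w, Subtype.ext hw.symm⟩
  exact ⟨LinearEquiv.ofBijective lin hbij, fun w => rfl⟩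

/-- **Pairwise non-isomorphy transports**: a `ℂ[G]`-linear equivalence between the spans of two summands yields an EQUIVARIANT `ℂ`-linear
equivalence of the printed summands, so the [Liu2021, Lem. D.1 (3)]-shaped row `hsepW` identifies the indices. [cite: Liu2021, Lem. D.1 (3) and Thm. 4.18 (2)] -/
theorem eq_of_linearEquiv_span_summand (σ413 : ∀ t, Representation ℂ G (W413 t)) (Φ413 : Hc ≃ₗ[ℂ] ⨁ t, W413 t)
    (hΦ413 : ∀ (g : G) (x : Hc) (t : ι413), Φ413 (Representation.ofModule' (k := ℂ) (G := G) Hc g x) t = σ413 t g (Φ413 x t))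
    (hsepW : ∀ s t : ι413, Nontrivial (W413 s) →
      (∃ f : W413 s ≃ₗ[ℂ] W413 t, ∀ (g : G) (v : W413 s), f (σ413 s g v) = σ413 t g (f v)) → s = t)
    (s t : ι413) [hs : Nontrivial (W413 s)]
    (e : ↥(Submodule.span (MonoidAlgebra ℂ G) (Set.range fun w : W413 s => Φ413.symm (lof ℂ ι413 W413 s w))) ≃ₗ[MonoidAlgebra ℂ G]
      ↥(Submodule.span (MonoidAlgebra ℂ G) (Set.range fun w : W413 t => Φ413.symm (lof ℂ ι413 W413 t w)))) :
    s = t := by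
  obtain ⟨es, hes⟩ := exists_linearEquiv_span_summand σ413 Φ413 hΦ413 s
  obtain ⟨et, het⟩ := exists_linearEquiv_span_summand σ413 Φ413 hΦ413 t
  refine hsepW s t hs ⟨es.trans ((e.restrictScalars ℂ).trans et.symm), fun g v => ?_⟩
  apply et.injective
  apply Subtype.ext
  simp only [LinearEquiv.trans_apply, LinearEquiv.apply_symm_apply, LinearEquiv.restrictScalars_apply]
  -- both sides are `of g • e (es v)` in `Hc`
  have h1 : es (σ413 s g v) = MonoidAlgebra.of ℂ G g • es v := by
    apply Subtype.ext
    rw [Submodule.coe_smul, hes, hes, of_smul_symm_lof σ413 Φ413 hΦ413]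
  rw [h1, map_smul, Submodule.coe_smul, het, ← of_smul_symm_lof σ413 Φ413 hΦ413, ← het, LinearEquiv.apply_symm_apply]

/-- **THE TWO-SOCKET ENGINE IN THE TREE'S [Prop. 4.13]-CURRENCY** (binders `σ413 ∕ Φ413 ∕ hΦ413 ∕ h411W ∕ hsepW` shaped VERBATIM as in
✔ `HcmPieces.thm418Combined_of_asPrinted_resolved_of_decomposition` :204–:210, `h411W` weakened to its first clause): an equivariant
decomposition of the `ℂ[G]`-module `Hc` (= the tower `𝔇.H`) into irreducible-or-zero, pairwise non-isomorphic summands; SEPARATION over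
admissible restrictions into disjoint `(1,0)`∕`(0,1)` pieces; TWO injective `ℂ[G]`-linear maps `J J′ : W → Hc` out of a non-trivial `W`
whose images restrict into the `(0,1)`- resp. `(1,0)`-pieces ⟹ `False`.  (= `false_of_twoSocket_of_multiplicityFree` ∘
`multiplicityFree_of_iSupIndep_simple` on the summand spans.) [cite: Liu2021, Prop. 4.13, Def. 4.11, Lem. D.1 (3), Thm. 4.18 (1)]
[cite: VoisinHodgeI2002, §6.1.3 Cor. 6.14 and §7.3.2] -/
theorem false_of_twoSocket_of_equivariant_directSum
    (σ413 : ∀ t, Representation ℂ G (W413 t)) (Φ413 : Hc ≃ₗ[ℂ] ⨁ t, W413 t)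
    (hΦ413 : ∀ (g : G) (x : Hc) (t : ι413), Φ413 (Representation.ofModule' (k := ℂ) (G := G) Hc g x) t = σ413 t g (Φ413 x t))
    (h411W : ∀ t, IsIrreducibleOrZero (σ413 t))
    (hsepW : ∀ s t : ι413, Nontrivial (W413 s) →
      (∃ f : W413 s ≃ₗ[ℂ] W413 t, ∀ (g : G) (v : W413 s), f (σ413 s g v) = σ413 t g (f v)) → s = t)
    {Λ : Type*} {Vp : Λ → Type*} [∀ i, AddCommGroup (Vp i)] [∀ i, Module ℂ (Vp i)]
    (res : ∀ i : Λ, Hc → Vp i) (adm : Λ → Hc → Prop) (V₁₀ V₀₁ : ∀ i : Λ, Submodule ℂ (Vp i))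
    (hdisj : ∀ i, Disjoint (V₁₀ i) (V₀₁ i))
    (sep : ∀ N : Submodule (MonoidAlgebra ℂ G) Hc, (∀ i, ∀ y ∈ N, adm i y → res i y = 0) → N = ⊥)
    {W : Type*} [AddCommGroup W] [Module (MonoidAlgebra ℂ G) W] [Nontrivial W]
    (J J' : W →ₗ[MonoidAlgebra ℂ G] Hc) (hJ : Injective J) (hJ' : Injective J')
    (hJ₀₁ : ∀ i w, adm i (J w) → res i (J w) ∈ V₀₁ i) (hJ'₁₀ : ∀ i w, adm i (J' w) → res i (J' w) ∈ V₁₀ i) : False := by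
  classical
  let ω : {t : ι413 // Nontrivial (W413 t)} → Submodule (MonoidAlgebra ℂ G) Hc := fun t =>
    Submodule.span (MonoidAlgebra ℂ G) (Set.range fun w : W413 t.1 => Φ413.symm (lof ℂ ι413 W413 t.1 w))
  have hsimple : ∀ t, IsSimpleModule (MonoidAlgebra ℂ G) (ω t) := fun t =>
    haveI := t.2; isSimpleModule_span_summand σ413 Φ413 hΦ413 t.1 (h411W t.1)
  have hsep' : ∀ t t', Nonempty (ω t ≃ₗ[MonoidAlgebra ℂ G] ω t') → t = t' := fun t t' ⟨e⟩ =>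
    Subtype.ext (haveI := t.2; eq_of_linearEquiv_span_summand σ413 Φ413 hΦ413 hsepW t.1 t'.1 e)
  have hind : iSupIndep ω := iSupIndep_span_summand σ413 Φ413 hΦ413
  have htop : ⨆ t, ω t = ⊤ := iSup_span_summand_eq_top Φ413
  haveI : IsSemisimpleModule (MonoidAlgebra ℂ G) Hc := isSemisimpleModule_of_iSup_simple_eq_top ω hsimple htop
  exact false_of_twoSocket_of_multiplicityFree (multiplicityFree_of_iSupIndep_simple ω hsimple hsep' hind htop)
    res adm V₁₀ V₀₁ hdisj sep J J' hJ hJ' hJ₀₁ hJ'₁₀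

end DirectSum413


/-! ## §3 Entry point in REPRESENTATION currency (the HEAD's sockets give `ℂ`-linear equivariant maps out of `ℂ ⊗ Ω(ν)`) -/

section RepEntry

variable {G : Type} [Group G]
variable {Hc : Type} [AddCommGroup Hc] [Module ℂ Hc] [Module (MonoidAlgebra ℂ G) Hc] [IsScalarTower ℂ (MonoidAlgebra ℂ G) Hc]
variable {ι413 : Type} [DecidableEq ι413] {W413 : ι413 → Type} [∀ t, AddCommGroup (W413 t)] [∀ t, Module ℂ (W413 t)]

/-- A `ℂ`-linear map out of a representation space that intertwines `ρ g` with `of g •` is `ℂ[G]`-linear for the `ℂ[G]`-module structure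
`Module.compHom _ ρ.asAlgebraHom` (the structure of `ρ.asModule`, placed on the space itself). [folklore] -/
theorem exists_linearMap_monoidAlgebra_of_equivariant {Vρ : Type*} [AddCommGroup Vρ] [Module ℂ Vρ] (ρ : Representation ℂ G Vρ)
    (f : Vρ →ₗ[ℂ] Hc) (hf : ∀ (g : G) (x : Vρ), f (ρ g x) = MonoidAlgebra.of ℂ G g • f x) :
    letI : Module (MonoidAlgebra ℂ G) Vρ := Module.compHom Vρ (Representation.asAlgebraHom ρ).toRingHom
    ∃ fR : Vρ →ₗ[MonoidAlgebra ℂ G] Hc, ∀ x, fR x = f x := by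
  letI : Module (MonoidAlgebra ℂ G) Vρ := Module.compHom Vρ (Representation.asAlgebraHom ρ).toRingHom
  have hsmul : ∀ (r : MonoidAlgebra ℂ G) (x : Vρ), r • x = Representation.asAlgebraHom ρ r x := fun _ _ => rfl
  refine ⟨{ toFun := f, map_add' := f.map_add, map_smul' := fun r x => ?_ }, fun x => rfl⟩
  rw [RingHom.id_apply, hsmul]
  induction r using MonoidAlgebra.induction_linear with
  | zero => rw [map_zero, LinearMap.zero_apply, map_zero, zero_smul]
  | add r s hr hs => rw [map_add, LinearMap.add_apply, map_add, hr, hs, add_smul]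
  | single g c =>
    have hs : MonoidAlgebra.single g c = c • MonoidAlgebra.of ℂ G g := by
      rw [MonoidAlgebra.of_apply, MonoidAlgebra.smul_single', mul_one]
    rw [Representation.asAlgebraHom_single, LinearMap.smul_apply, map_smul, hf, hs, smul_assoc]

/-- **THE TWO-SOCKET ENGINE, representation currency** — as `false_of_twoSocket_of_equivariant_directSum`, but the common source is a
`ℂ`-representation `(Vρ, ρ)` and `J, J′ : Vρ →ₗ[ℂ] Hc` are `ℂ`-linear maps intertwining `ρ g` with the action of `of g` (at the pin:
`Vρ := ℂ ⊗_{M_ν} Ω(ν)`, `ρ g := (D.rhoΩ g).baseChange ℂ`, `J := jH ∘ M.J` with ✔ `Map43RationalData.hJ` + `jHPin_comm`, injectivity ✔ `injective_J`).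
[cite: Liu2021, Prop. 4.13, Def. 4.11, Lem. D.1 (3), Thm. 4.18 (1) and proof (4.3)] [cite: VoisinHodgeI2002, §6.1.3 Cor. 6.14 and §7.3.2] -/
theorem false_of_twoSocket_of_equivariant_directSum_rep
    (σ413 : ∀ t, Representation ℂ G (W413 t)) (Φ413 : Hc ≃ₗ[ℂ] ⨁ t, W413 t)
    (hΦ413 : ∀ (g : G) (x : Hc) (t : ι413), Φ413 (Representation.ofModule' (k := ℂ) (G := G) Hc g x) t = σ413 t g (Φ413 x t))
    (h411W : ∀ t, IsIrreducibleOrZero (σ413 t))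
    (hsepW : ∀ s t : ι413, Nontrivial (W413 s) →
      (∃ f : W413 s ≃ₗ[ℂ] W413 t, ∀ (g : G) (v : W413 s), f (σ413 s g v) = σ413 t g (f v)) → s = t)
    {Λ : Type*} {Vp : Λ → Type*} [∀ i, AddCommGroup (Vp i)] [∀ i, Module ℂ (Vp i)]
    (res : ∀ i : Λ, Hc → Vp i) (adm : Λ → Hc → Prop) (V₁₀ V₀₁ : ∀ i : Λ, Submodule ℂ (Vp i))
    (hdisj : ∀ i, Disjoint (V₁₀ i) (V₀₁ i))
    (sep : ∀ N : Submodule (MonoidAlgebra ℂ G) Hc, (∀ i, ∀ y ∈ N, adm i y → res i y = 0) → N = ⊥)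
    {Vρ : Type*} [AddCommGroup Vρ] [Module ℂ Vρ] [Nontrivial Vρ] (ρ : Representation ℂ G Vρ)
    (J J' : Vρ →ₗ[ℂ] Hc)
    (hJG : ∀ (g : G) (x : Vρ), J (ρ g x) = MonoidAlgebra.of ℂ G g • J x)
    (hJ'G : ∀ (g : G) (x : Vρ), J' (ρ g x) = MonoidAlgebra.of ℂ G g • J' x)
    (hJ : Injective J) (hJ' : Injective J')
    (hJ₀₁ : ∀ i x, adm i (J x) → res i (J x) ∈ V₀₁ i) (hJ'₁₀ : ∀ i x, adm i (J' x) → res i (J' x) ∈ V₁₀ i) : False := by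
  letI : Module (MonoidAlgebra ℂ G) Vρ := Module.compHom Vρ (Representation.asAlgebraHom ρ).toRingHom
  obtain ⟨JR, hJR⟩ := exists_linearMap_monoidAlgebra_of_equivariant (Hc := Hc) ρ J hJG
  obtain ⟨J'R, hJ'R⟩ := exists_linearMap_monoidAlgebra_of_equivariant (Hc := Hc) ρ J' hJ'G
  refine false_of_twoSocket_of_equivariant_directSum σ413 Φ413 hΦ413 h411W hsepW res adm V₁₀ V₀₁ hdisj sep JR J'R
    (fun a b hab => hJ (by rw [← hJR, ← hJR]; exact hab)) (fun a b hab => hJ' (by rw [← hJ'R, ← hJ'R]; exact hab))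
    (fun i x h => ?_) (fun i x h => ?_)
  · rw [hJR] at h ⊢; exact hJ₀₁ i x h
  · rw [hJ'R] at h ⊢; exact hJ'₁₀ i x h

end RepEntry

end Summit.HodgeConjecture.CorCM.D2Bridge.NotHJ

end
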